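import Summits.ResolutionOfSingularities.ResolutionOfSingularities.Theorems.FrobeniusLadderFRationalResolutionConeChartRecursion
import Summits.ResolutionOfSingularities.ResolutionOfSingularities.Theorems.FrobeniusLadderFRationalResolutionConeChartRoundZero
import Summits.ResolutionOfSingularities.ResolutionOfSingularities.Theorems.FrobeniusLadderFRationalResolutionBaseChartAlgebra
import Summits.ResolutionOfSingularities.ResolutionOfSingularities.Theorems.FrobeniusLadderFRationalResolutionIsolatedQuotientResolution
import Summits.ResolutionOfSingularities.ResolutionOfSingularities.Theorems.FrobeniusLadderFRationalResolutionDiagQuotientSurface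
import Mathlib.AlgebraicGeometry.Properties
import HarnessLib

/-!
# Crux `FrobeniusLadder.FRationalResolution` (stmt-ResolutionOfSingularities-15317), line `redirect`,
# stub `stub_diagonalizableQuotientResolution` — **THE SURFACE CASE OVER EVERY FIELD** (bricks P7-0 and P7-e of
# memo MEMO-15317-leafhand2-g8 §8–§9: round 0 + the point-blow-up recursion `…ConeChartRecursion` + assembly)

* `hloc_of_sharp_chart` — ROUND 0: at a singular point `x = φ y` of a surface (`dim 𝒪_{X,x} ≤ 2`) presented by an
  étale `φ : Spec R → X` with a sharp log regular chart `ψ : P → R` (unit face `0` at `y`), the package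
  `…ConeChartRoundZero.exists_roundZero_package` makes `(Γ(V), P, ψ_V, 𝔮_y)` a cone chart algebra point of
  measure `d` over ITSELF (`…BaseChartAlgebra`) with the étale roof `X ← V ≅ Spec Γ(V)`; `…ConeChartRecursion`
  gives `hloc` at `x`;
* `hasResolution_of_sharp_charts_of_surface` — integral `X` locally of finite type over ANY field, finitely many
  singular points of local dimension `≤ 2`, each with such a chart ⇒ `X` has a resolution (`…IsolatedGlue`);
* **`hasResolution_of_quotient_surface`** / **`stub_diagonalizableQuotientResolution_of_surface`** — the stub
  `stub_diagonalizableQuotientResolution` VERBATIM plus `dim X ≤ 2`, over EVERY field `k` (tame or wild, `k`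
  perfect or not): diagonalizable quotient surface singularities presented by étale charts from degree-`0` parts of
  regular finite-type graded algebras are resolvable — by `…IsolatedQuotientResolution.exists_sharp_affine_chart`
  (leafhand-4) and the Hirzebruch–Jung point-blow-up recursion of lineage 2 (no residue-field hypothesis: the
  centres are the singular points themselves).

Honest label: closes the SURFACE CASE of ONE leaf stub over arbitrary fields; the stub in dimension `≥ 3`
(non-isolated singularities; Bergh–Rydh destackification for perfect `k`) is untouched; no stub, crux or summit is
closed by name. No definitions, no named facts, no sorry. [cite: Kollar2007, §2.2] [cite: Kato1994, (10.1), (10.3)]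
[cite: Lipman1978, §2]
-/

noncomputable section

-- single-problem summit: the doubled namespace component is forced
set_option linter.dupNamespace false

open CategoryTheory AlgebraicGeometry TopologicalSpace
open IsLocalRing Literature.AlgebraicGeometry.Resolution Literature.AlgebraicGeometry.Resolution.LogChart
open Summit.ResolutionOfSingularities.ResolutionOfSingularities.Theorems.FRationalResolution

namespace Summit.ResolutionOfSingularities.ResolutionOfSingularities.Theorems.FRationalResolution.DiagQuotientSurfaceAllFields

/-- **ROUND 0 + RECURSION: `hloc` at a singular surface point with a sharp log regular étale chart.** See the module
docstring. [cite: Kollar2007, §2.2] [cite: Kato1994, (10.1), (10.3)] -/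
theorem hloc_of_sharp_chart (K : Type) [Field K] (X : Scheme.{0}) [IsIntegral X] (f : X ⟶ Spec (.of K))
    [LocallyOfFiniteType f] (hfin : (Scheme.regularLocus X)ᶜ.Finite)
    (R : CommRingCat.{0}) (φ : Spec R ⟶ X) [Etale φ] (y : Spec R) (hx : φ y ∉ Scheme.regularLocus X)
    (hdimx : ringKrullDim (X.presheaf.stalk (φ y)) ≤ (2 : ℕ))
    {n : ℕ} (P : AddSubmonoid (Fin n → ℤ)) (hP : P.FG)
    (hsat : ∀ (v : Fin n → ℤ) (k : ℕ), 0 < k → k • v ∈ P → v ∈ P)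
    (hspan : Submodule.span ℤ (P : Set (Fin n → ℤ)) = ⊤) (ψ : Multiplicative P →* R) (g : R)
    (hgy : g ∉ y.asIdeal) (hreg : ∀ (𝔭 : Ideal R) [𝔭.IsPrime], g ∉ 𝔭 → IsLogRegularAt P ψ 𝔭)
    (hfix : ∀ p : P, (p : Fin n → ℤ) ≠ 0 → ψ (Multiplicative.ofAdd p) ∈ y.asIdeal) :
    ∃ (W : X.Opens), φ y ∈ W ∧ (∀ t : X, t ∉ Scheme.regularLocus X → t ∈ W → t = φ y) ∧
      ∃ (Z : Scheme.{0}) (π : Z ⟶ W), IsProper π ∧ Scheme.IsRegular Z ∧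
        IsIso (π ∣_ (W.ι ⁻¹ᵁ ⟨Scheme.regularLocus X, isOpen_regularLocus_of_locallyOfFiniteType_field f⟩)) ∧
        Dense ((π ⁻¹ᵁ (W.ι ⁻¹ᵁ ⟨Scheme.regularLocus X,
          isOpen_regularLocus_of_locallyOfFiniteType_field f⟩) : Z.Opens) : Set Z) := by
  classical
  haveI : IsLocallyNoetherian X := LocallyOfFiniteType.isLocallyNoetherian f
  haveI : IsLocallyNoetherian (Spec R) := LocallyOfFiniteType.isLocallyNoetherian φ
  obtain ⟨hn, -, V, hV, hyV, -, hregV, -, -, -, -, u, e, d, a, -, had, hind, hspan₀, hmem, h0, hdim2⟩ :=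
    ConeChartRoundZero.exists_roundZero_package K X f hfin R φ y hx hdimx P hP hsat hspan ψ g hgy hreg hfix
  subst hn
  haveI : IsNoetherianRing Γ(Spec R, V) := IsLocallyNoetherian.component_noetherian ⟨V, hV⟩
  haveI : (hV.primeIdealOf ⟨y, hyV⟩).asIdeal.IsPrime := (hV.primeIdealOf ⟨y, hyV⟩).isPrime
  -- the fixed prime is `𝔮_y` itself: it contains `ψ_V(P ∖ ℤF)`
  have h𝔓q : ∀ q : P, (q : Fin 2 → ℤ) ∉ Submodule.span ℤ (faceMonoid P
      ((algebraMap R Γ(Spec R, V)).toMonoidHom.comp ψ) (hV.primeIdealOf ⟨y, hyV⟩).asIdeal : Set (Fin 2 → ℤ)) →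
      ((algebraMap R Γ(Spec R, V)).toMonoidHom.comp ψ) (Multiplicative.ofAdd q) ∈
        (hV.primeIdealOf ⟨y, hyV⟩).asIdeal := by
    intro q hq
    by_contra hmem'
    apply hq
    refine Submodule.subset_span ((mem_faceMonoid P _ _).mpr ⟨q.2, ?_⟩)
    rw [val_of_mem P _ q.2]
    exact hmem'
  have h𝔓A : (hV.primeIdealOf ⟨y, hyV⟩).asIdeal.comap (algebraMap Γ(Spec R, V) Γ(Spec R, V)) =
      (hV.primeIdealOf ⟨y, hyV⟩).asIdeal :=
    Ideal.ext fun _ => Iff.rfl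
  -- the roof `X ←(ι ≫ φ)— V —≅→ Spec Γ(V)`
  have hx' : (V.ι ≫ φ) ⟨y, hyV⟩ ∉ Scheme.regularLocus X := by
    rw [Scheme.Hom.comp_apply, Scheme.Opens.ι_apply]; exact hx
  have hjy : (hV.isoSpec.hom ⟨y, hyV⟩).asIdeal = (hV.primeIdealOf ⟨y, hyV⟩).asIdeal := rfl
  have key := ConeChartRecursion.hloc_of_coneChart d K X f hfin (A := Γ(Spec R, V)) (C := Γ(Spec R, V))
    (𝔭 := (hV.primeIdealOf ⟨y, hyV⟩).asIdeal) had hP hsat hspan (hregV _) (le_refl P)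
    BaseChartAlgebra.self_chi BaseChartAlgebra.self_adjoin_eq_top BaseChartAlgebra.self_denominators
    BaseChartAlgebra.self_kernel BaseChartAlgebra.self_fieldExtension hP hmem hind hspan₀ h0.symm.le hdim2.le
    (hV.primeIdealOf ⟨y, hyV⟩).asIdeal h𝔓A h𝔓q (V.ι ≫ φ) hV.isoSpec.hom ⟨y, hyV⟩ hx' hjy
  have hpt : (V.ι ≫ φ) ⟨y, hyV⟩ = φ y := by rw [Scheme.Hom.comp_apply, Scheme.Opens.ι_apply]
  rw [hpt] at key
  exact key

/-- **Surfaces over any field whose isolated singular points carry sharp log regular étale charts are resolvable.**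
[cite: Kollar2007, §2.2] [cite: Kato1994, (10.1), (10.3)] -/
theorem hasResolution_of_sharp_charts_of_surface (K : Type) [Field K] (X : Scheme.{0}) [IsIntegral X]
    (f : X ⟶ Spec (.of K)) [LocallyOfFiniteType f] (hfin : (Scheme.regularLocus X)ᶜ.Finite)
    (hdim : ∀ x : X, x ∉ Scheme.regularLocus X → ringKrullDim (X.presheaf.stalk x) ≤ (2 : ℕ))
    (hchart : ∀ x : X, x ∉ Scheme.regularLocus X →
      ∃ (R : CommRingCat.{0}) (φ : Spec R ⟶ X) (_ : Etale φ) (y : Spec R) (_ : φ y = x)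
        (n : ℕ) (P : AddSubmonoid (Fin n → ℤ)) (_ : P.FG)
        (_ : ∀ (v : Fin n → ℤ) (k : ℕ), 0 < k → k • v ∈ P → v ∈ P)
        (_ : Submodule.span ℤ (P : Set (Fin n → ℤ)) = ⊤)
        (ψ : Multiplicative P →* R) (g : R),
        g ∉ y.asIdeal ∧
        (∀ (𝔭 : Ideal R) [𝔭.IsPrime], g ∉ 𝔭 → IsLogRegularAt P ψ 𝔭) ∧
        (∀ p : P, (p : Fin n → ℤ) ≠ 0 → ψ (Multiplicative.ofAdd p) ∈ y.asIdeal)) :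
    Scheme.HasResolution X := by
  refine IsolatedGlue.hasResolution_of_finite_singularLocus_of_local K X f hfin fun s hs => ?_
  obtain ⟨R, φ, _, y, hyx, n, P, hP, hsat, hspan, ψ, g, hgy, hreg, hfix⟩ := hchart s hs
  subst hyx
  exact hloc_of_sharp_chart K X f hfin R φ y hs (hdim _ hs) P hP hsat hspan ψ g hgy hreg hfix

/-- **DIAGONALIZABLE QUOTIENT SURFACE SINGULARITIES ARE RESOLVABLE OVER EVERY FIELD** (hypothesis `hq` of the stub
verbatim, `dim X ≤ 2`; tame or wild, `k` arbitrary). [cite: Kollar2007, §2.2] [cite: Kato1994, (10.1), (10.3)]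
[cite: Lipman1978, §2] -/
theorem hasResolution_of_quotient_surface (k : Type) [Field k] (X : Scheme.{0}) (g : X ⟶ Spec (.of k))
    [IsIntegral X] [LocallyOfFiniteType g] [QuasiCompact g]
    (hq : ∀ x : X, ∃ (A : Type) (_ : AddCommGroup A) (_ : Finite A) (_ : DecidableEq A)
        (S : Type) (_ : CommRing S) (_ : Algebra k S) (𝒮 : A → Submodule k S)
        (_ : GradedAlgebra 𝒮), Algebra.FiniteType k S ∧ IsRegularRing S ∧
        ∃ φ : Spec (.of (𝒮 0)) ⟶ X, Etale φ ∧ x ∈ Set.range φ ∧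
          φ ≫ g = Spec.map (CommRingCat.ofHom (algebraMap k (𝒮 0))))
    (hdim : topologicalKrullDim X ≤ 2) :
    Scheme.HasResolution X := by
  classical
  obtain ⟨hfin, -⟩ := DiagQuotientSurface.diagQuotient_surface_singularLocus k X g hq hdim
  refine hasResolution_of_sharp_charts_of_surface k X g hfin (fun x _ => ?_) fun x hx => ?_
  · -- `dim 𝒪_{X,x} ≤ dim X ≤ 2`
    have h1 : ringKrullDim (X.presheaf.stalk x) ≤ topologicalKrullDim X := by
      rw [AlgebraicGeometry.ringKrullDim_stalk_eq_coheight, topologicalKrullDim,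
        Order.krullDim_eq_of_orderIso (irreducibleSetEquivPoints (α := X))]
      exact Order.coheight_le_krullDim x
    exact h1.trans (by exact_mod_cast hdim)
  · obtain ⟨A, _, _, _, S, _, _, 𝒮, _, hft, hregS, φ, hφ, ⟨v, hv⟩, -⟩ := hq x
    haveI := hft
    haveI := hregS
    haveI := hφ
    obtain ⟨R, _, ι, hιet, w, hw, n, P, hP, hsat, hspan, χ, g', hgw, hreg, hfix, -⟩ :=
      IsolatedQuotientResolution.exists_sharp_affine_chart k A S 𝒮 v
    haveI : Etale (Spec.map (CommRingCat.ofHom ι)) := (HasRingHomProperty.Spec_iff (P := @Etale)).mpr hιet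
    have hw' : Spec.map (CommRingCat.ofHom ι) w = v := by
      apply PrimeSpectrum.ext
      rw [Spec.map_apply, PrimeSpectrum.comap_asIdeal]
      exact hw
    refine ⟨CommRingCat.of R, Spec.map (CommRingCat.ofHom ι) ≫ φ, inferInstance, w, ?_, n, P, hP, hsat, hspan, χ,
      g', hgw, hreg, hfix⟩
    show φ (Spec.map (CommRingCat.ofHom ι) w) = x
    rw [hw', hv]

end Summit.ResolutionOfSingularities.ResolutionOfSingularities.Theorems.FRationalResolution.DiagQuotientSurfaceAllFields

end

/-! ## Appendix (same generation): the stub's binders verbatim -/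

noncomputable section

-- single-problem summit: the doubled namespace component is forced
set_option linter.dupNamespace false

namespace Summit.ResolutionOfSingularities.ResolutionOfSingularities.Theorems.FRationalResolution.DiagQuotientSurfaceAllFields

open CategoryTheory AlgebraicGeometry Literature.AlgebraicGeometry.Resolution

/-- **`stub_diagonalizableQuotientResolution` IN DIMENSION `≤ 2` OVER EVERY FIELD** (binders of the stub verbatim,
plus `topologicalKrullDim X ≤ 2`). [cite: Kollar2007, §2.2] [cite: Kato1994, (10.1), (10.3)] [cite: Lipman1978, §2] -/
theorem stub_diagonalizableQuotientResolution_of_surface (k : Type) [Field k] (X : Scheme.{0})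
    (g : X ⟶ Spec (.of k)) [IsIntegral X] [IsSeparated g] [LocallyOfFiniteType g] [QuasiCompact g]
    (hq : ∀ x : X, ∃ (A : Type) (_ : AddCommGroup A) (_ : Finite A) (_ : DecidableEq A)
        (S : Type) (_ : CommRing S) (_ : Algebra k S) (𝒮 : A → Submodule k S)
        (_ : GradedAlgebra 𝒮), Algebra.FiniteType k S ∧ IsRegularRing S ∧
        ∃ φ : Spec (.of (𝒮 0)) ⟶ X, Etale φ ∧ x ∈ Set.range φ ∧
          φ ≫ g = Spec.map (CommRingCat.ofHom (algebraMap k (𝒮 0))))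
    (hdim : topologicalKrullDim X ≤ 2) :
    Scheme.HasResolution X :=
  hasResolution_of_quotient_surface k X g hq hdim

end Summit.ResolutionOfSingularities.ResolutionOfSingularities.Theorems.FRationalResolution.DiagQuotientSurfaceAllFields

end

/-! ## Appendix 2 (same generation): isolated quotient singularities of local dimension `≤ 2`, any field -/

noncomputable section

-- single-problem summit: the doubled namespace component is forced
set_option linter.dupNamespace false

namespace Summit.ResolutionOfSingularities.ResolutionOfSingularities.Theorems.FRationalResolution.DiagQuotientSurfaceAllFields

open CategoryTheory AlgebraicGeometry Literature.AlgebraicGeometry.Resolution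

/-- **ISOLATED diagonalizable quotient singularities of local dimension `≤ 2` are resolvable over EVERY field** (the
all-fields counterpart of `…IsolatedQuotientResolution.hasResolution_of_isolated_quotient_charts_of_isAlgClosed` in
local dimension `≤ 2`; `X` itself may have any dimension): `X` integral, locally of finite type over any field `K`,
finitely many singular points, each with `dim 𝒪_{X,x} ≤ 2` and in the image of an étale `Spec S₀ → X`, `S` regular
of finite type graded by a finite abelian group. [cite: Kollar2007, §2.2] [cite: Kato1994, (10.1), (10.3)] -/
theorem hasResolution_of_isolated_quotient_charts_of_dim_le_two (K : Type) [Field K]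
    (X : Scheme.{0}) [IsIntegral X] (f : X ⟶ Spec (.of K)) [LocallyOfFiniteType f]
    (hfin : (Scheme.regularLocus X)ᶜ.Finite)
    (hdim : ∀ x : X, x ∉ Scheme.regularLocus X → ringKrullDim (X.presheaf.stalk x) ≤ (2 : ℕ))
    (hq : ∀ x : X, x ∉ Scheme.regularLocus X →
      ∃ (A : Type) (_ : AddCommGroup A) (_ : Finite A) (_ : DecidableEq A)
        (S : Type) (_ : CommRing S) (_ : Algebra K S) (𝒮 : A → Submodule K S)
        (_ : GradedAlgebra 𝒮), Algebra.FiniteType K S ∧ IsRegularRing S ∧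
        ∃ φ : Spec (.of (𝒮 0)) ⟶ X, Etale φ ∧ x ∈ Set.range φ) :
    Scheme.HasResolution X := by
  classical
  refine hasResolution_of_sharp_charts_of_surface K X f hfin hdim fun x hx => ?_
  obtain ⟨A, _, _, _, S, _, _, 𝒮, _, hft, hregS, φ, hφ, ⟨v, hv⟩⟩ := hq x hx
  haveI := hft
  haveI := hregS
  haveI := hφ
  obtain ⟨R, _, ι, hιet, w, hw, n, P, hP, hsat, hspan, χ, g', hgw, hreg, hfix, -⟩ :=
    IsolatedQuotientResolution.exists_sharp_affine_chart K A S 𝒮 v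
  haveI : Etale (Spec.map (CommRingCat.ofHom ι)) := (HasRingHomProperty.Spec_iff (P := @Etale)).mpr hιet
  have hw' : Spec.map (CommRingCat.ofHom ι) w = v := by
    apply PrimeSpectrum.ext
    rw [Spec.map_apply, PrimeSpectrum.comap_asIdeal]
    exact hw
  refine ⟨CommRingCat.of R, Spec.map (CommRingCat.ofHom ι) ≫ φ, inferInstance, w, ?_, n, P, hP, hsat, hspan, χ,
    g', hgw, hreg, hfix⟩
  show φ (Spec.map (CommRingCat.ofHom ι) w) = x
  rw [hw', hv]

end Summit.ResolutionOfSingularities.ResolutionOfSingularities.Theorems.FRationalResolution.DiagQuotientSurfaceAllFields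

end
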